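import Literature.MathematicalPhysics.QuantumFieldTheory.YangMillsOS

/-!
# Negative knowledge for crux `OSLegsFromFemtoAndGap` (stmt-QuantumFields-9367): the gap clause is
antitone in the unit map

Support file (`--supports stmt-QuantumFields-9367`, cdisprove gen 2 cycle 1; mirrors the §6
addendum of `Summits/QuantumFields/YangMills/Cruxes/OSLegsFromFemtoAndGap/Disproof.lean`).
`gapInUnits_mono`: hypothesis H3 of the crux (the body of `LatticeGapInUVUnits`' conclusion,
spelled out) for a unit map `a` implies H3 for every unit map `a'` with `a' ≤ a` above a threshold
— same rate `c₁`, same `S₁`, constants `max C 0`, threshold `max β₂ βs`; no positivity of `a'`.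
So along a deformation `a' ≪ a` of the unit map the gap clause only weakens: it cannot be the
hypothesis that excludes unit maps decaying faster than the physical spacing. No route decl is
asserted or denied here.
-/

namespace Summit.QuantumFields.YangMills.Theorems.OSLegsFromFemtoAndGap.Negative

open Literature.MathematicalPhysics.QuantumFieldTheory

variable {G : Type} [Group G] [TopologicalSpace G] [IsTopologicalGroup G] [CompactSpace G]
  [MeasurableSpace G] [BorelSpace G]

/-- **H3 is antitone in the unit map** (verbatim H3 bodies): `a' ≤ a` on `[βs, ∞)` and H3 for `a`
give H3 for `a'`. [folklore] -/
theorem gapInUnits_mono (r : LatticeRep G) {a a' : ℝ → ℝ} (βs : ℝ)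
    (hle : ∀ β, βs ≤ β → a' β ≤ a β)
    (h : ∃ (c₁ β₂ : ℝ) (S₁ : ℝ → ℕ), 0 < c₁ ∧ ∀ A B : YMSpecies G, ∃ C : ℝ, ∀ β : ℝ, β₂ ≤ β →
      ∀ S n : ℕ, S₁ β ≤ S → n ≤ S →
        |latticeConnectedCorr r.ρ β (2 * S + 1) A.F B.F n| ≤ C * Real.exp (-(c₁ * a β * n))) :
    ∃ (c₁ β₂ : ℝ) (S₁ : ℝ → ℕ), 0 < c₁ ∧ ∀ A B : YMSpecies G, ∃ C : ℝ, ∀ β : ℝ, β₂ ≤ β →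
      ∀ S n : ℕ, S₁ β ≤ S → n ≤ S →
        |latticeConnectedCorr r.ρ β (2 * S + 1) A.F B.F n| ≤ C * Real.exp (-(c₁ * a' β * n)) := by
  obtain ⟨c₁, β₂, S₁, hc, H⟩ := h
  refine ⟨c₁, max β₂ βs, S₁, hc, fun A B => ?_⟩
  obtain ⟨C, hC⟩ := H A B
  refine ⟨max C 0, fun β hβ S n hS hn => ?_⟩
  have h1 := hC β (le_of_max_le_left hβ) S n hS hn
  have hexp : Real.exp (-(c₁ * a β * n)) ≤ Real.exp (-(c₁ * a' β * n)) := by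
    apply Real.exp_le_exp.mpr
    have := hle β (le_of_max_le_right hβ)
    have hn0 : (0 : ℝ) ≤ n := Nat.cast_nonneg n
    nlinarith [mul_le_mul_of_nonneg_right this hn0]
  calc |latticeConnectedCorr r.ρ β (2 * S + 1) A.F B.F n| ≤ C * Real.exp (-(c₁ * a β * n)) := h1
    _ ≤ max C 0 * Real.exp (-(c₁ * a β * n)) :=
        mul_le_mul_of_nonneg_right (le_max_left _ _) (Real.exp_pos _).le
    _ ≤ max C 0 * Real.exp (-(c₁ * a' β * n)) :=
        mul_le_mul_of_nonneg_left hexp (le_max_right _ _)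

end Summit.QuantumFields.YangMills.Theorems.OSLegsFromFemtoAndGap.Negative
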